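import Mathlib

/-!
# Tier4/Line1/InfinitePrimes — a number field has infinitely many finite places

Blind re-derivation cell `pub-hodge-repro`, Tier 4 (README §9–§10), seat t4-L1-p5 (prover, LINE L1, gen 0).
Mathlib only: every rational prime `p` lies under some prime of `𝓞_k` (`(p)` is proper because its absolute norm is
`p^{[k:ℚ]} ≠ 1`), and distinct rational primes lie under distinct primes (Bézout), so `HeightOneSpectrum (𝓞 k)` is
infinite.  Used by `Tier4/Line1/SignAdele.lean` (the sign adeles `ε_v` tend to `1` along the places).

Nothing here says anything about the status of the Hodge conjecture for CM abelian varieties, which is NOT proved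
(HC_CM is NOT proved by anyone in this repository).
-/

set_option autoImplicit false
noncomputable section
namespace Summit.Ventures.HodgeRepro.Tier4.Line1
open NumberField IsDedekindDomain

variable (k : Type) [Field k] [NumberField k]

/-- For a rational prime `p`, the principal ideal `(p)` of `𝓞_k` is proper. -/
theorem span_prime_ne_top (p : ℕ) (hp : p.Prime) :
    Ideal.span {(p : 𝓞 k)} ≠ ⊤ := by
  intro h
  have h1 : Ideal.absNorm (Ideal.span {(p : 𝓞 k)}) = 1 := by
    rw [h]; exact Ideal.absNorm_top
  rw [Ideal.absNorm_span_singleton] at h1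
  have h2 : Algebra.norm ℤ ((p : ℤ) : 𝓞 k) = (p : ℤ) ^ Module.finrank ℤ (𝓞 k) := by
    rw [show ((p : ℤ) : 𝓞 k) = algebraMap ℤ (𝓞 k) (p : ℤ) from rfl]
    exact Algebra.norm_algebraMap (p : ℤ)
  have h3 : ((p : ℤ) : 𝓞 k) = (p : 𝓞 k) := by push_cast; rfl
  rw [h3] at h2
  rw [h2, Int.natAbs_pow, Int.natAbs_natCast] at h1
  have hn : 0 < Module.finrank ℤ (𝓞 k) := Module.finrank_pos
  have := Nat.pow_eq_one.1 h1
  rcases this with h | h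
  · exact hp.one_lt.ne' h
  · exact hn.ne' h

/-- A prime of `𝓞_k` above a given rational prime. -/
theorem exists_heightOneSpectrum_mem (p : ℕ) (hp : p.Prime) :
    ∃ v : HeightOneSpectrum (𝓞 k), (p : 𝓞 k) ∈ v.asIdeal := by
  obtain ⟨M, hM, hpM⟩ := Ideal.exists_le_maximal _ (span_prime_ne_top k p hp)
  have hne : M ≠ ⊥ := by
    intro h
    have : (p : 𝓞 k) ∈ M := hpM (Ideal.mem_span_singleton_self _)
    rw [h, Ideal.mem_bot] at this
    exact hp.ne_zero (by exact_mod_cast this)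
  exact ⟨⟨M, hM.isPrime, hne⟩, hpM (Ideal.mem_span_singleton_self _)⟩

/-- **There are infinitely many primes of `𝓞_k`** (distinct rational primes lie under distinct primes). -/
theorem infinite_heightOneSpectrum : Infinite (HeightOneSpectrum (𝓞 k)) := by
  classical
  let f : Nat.Primes → HeightOneSpectrum (𝓞 k) := fun p =>
    Classical.choose (exists_heightOneSpectrum_mem k p.1 p.2)
  have hf : ∀ p : Nat.Primes, (p.1 : 𝓞 k) ∈ (f p).asIdeal := fun p =>
    Classical.choose_spec (exists_heightOneSpectrum_mem k p.1 p.2)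
  have hinj : Function.Injective f := by
    intro p q hpq
    by_contra hne
    have hne' : p.1 ≠ q.1 := fun h => hne (Subtype.ext h)
    have hcop : IsCoprime (p.1 : ℤ) (q.1 : ℤ) :=
      Nat.isCoprime_iff_coprime.2 ((Nat.coprime_primes p.2 q.2).2 hne')
    obtain ⟨a, b, hab⟩ := hcop
    have h1 : ((a * p.1 + b * q.1 : ℤ) : 𝓞 k) ∈ (f p).asIdeal := by
      push_cast
      refine Ideal.add_mem _ (Ideal.mul_mem_left _ _ ?_) (Ideal.mul_mem_left _ _ ?_)
      · exact hf p
      · rw [hpq]; exact hf q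
    rw [hab] at h1
    simp only [Int.cast_one] at h1
    exact (f p).isPrime.ne_top ((Ideal.eq_top_iff_one _).2 h1)
  exact Infinite.of_injective f hinj

end Summit.Ventures.HodgeRepro.Tier4.Line1
end
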